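import Literature.NumberTheory.EllipticCurves.PAdicLFunctionMinusDistributionProofs
import Literature.NumberTheory.EllipticCurves.PAdicLFunctionIntegralityAtTwoProofs
import HarnessLib

/-!
# The constant term of the odd branch `L⁻₂(f, α, ω, T)` at `p = 2`:
# `∫_{ℤ₂^×} ω dμ⁻_{f,α} = α⁻² · ([1/4]⁻_f − [3/4]⁻_f)` (proofs only)

Topic `NumberTheory/EllipticCurves`; namespace `Literature.NumberTheory.EllipticCurves`. THEOREMS ONLY (no
definition, no named fact; D-0014, D-0026). `PAdicLFunctionMinusDistributionProofs` evaluated the constant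
term of the minus `ω^i`-branch `padicLFunctionMinusBranch f α i = ∫ ω^i(x)(1+T)^{ℓ(x)} dμ⁻_{f,α}` as the finite
sum `Σ_{a ∈ (ℤ/p^{e₀})ˣ} μ⁻_{f,α}(a + p^{e₀}ℤ_p) ω(a)^i` (`constantCoeff_padicLFunctionMinusBranch_eq`,
`padicLMinusBranchRiemannSum_zero_eq`: the Riemann sums are constant in `n`). At `p = 2` (`e₀ = 2`, `γ = 5`,
torsion `{±1}` of `ℤ₂^×`; `cyclotomicExponent_two`, `torsionOrder_two`) and `i = 1` (`ω = χ₋₄`, the character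
of `Δ = {±1}`) this file computes that sum in closed form on the MINUS modular symbols:

* `padicLMinusBranchRiemannSum_one_zero_zero_two` — the level-`0` Riemann sum is
  `μ⁻(1 + 4ℤ₂) − μ⁻(3 + 4ℤ₂) = α⁻²([1/4]⁻ − [3/4]⁻)`: the two `α⁻³[a/2]⁻` terms of
  `μ⁻(a + 4ℤ₂) = α⁻²[a/4]⁻ − α⁻³[a/2]⁻` (Mazur–Tate–Teitelbaum §I.10 (10.1)) CANCEL, because
  `[3/2]⁻ = [1/2 + 1]⁻ = [1/2]⁻` (`ratMinusSymbol_add_intCast`) — no distribution relation needed;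
* `constantCoeff_padicLFunctionMinusBranch_one_two` — granted the distribution relation of `μ⁻_{f,α}`
  (`hdist`; for a rational newform and a root `α` of `X² − a₂X + 2` it is the tree's
  `sum_fiber_msdMinusMeasure_succ_eq_of_coeffField`),
  `constantCoeff (padicLFunctionMinusBranch f α 1) = α⁻² · ([1/4]⁻_f − [3/4]⁻_f)` in `ℚ₂`;
* `constantCoeff_padicLFunctionMinusBranch_one_two_of_coeffField` — the same for a rational newform
  `f` of level prime to `2` and `α` a root of `X² − a₂X + 2`, hypotheses discharged.

`[1/4]⁻ − [3/4]⁻ = Σ_{a mod 4} χ₋₄(a)[a/4]⁻_f` is the minus twisted symbol sum of the odd character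
`χ₋₄` of conductor `4`; by Birch's formula (Mazur–Tate–Teitelbaum §I.8 (8.6), tree
`ratMinusTwistedSymbolSum_mul_minusPeriod_mul_I`, `τ(χ₋₄) = 2i`) it equals `2·L(f, χ₋₄, 1)/Ω⁻_f` — the
`T = 0` interpolation of the odd branch at `2` (MTT §I.14). That identification is NOT made here (it needs
`χ₋₄` as a primitive Dirichlet character and the value `τ(χ₋₄) = 2i`).

Motivation (cell `bsd-2adic`, seat `bsd-2adic-addL2` GEN 6, MEMO-5 §4 (G4)): the descent over
`K* = ℚ(i)` of the additive-at-`2` `K*`-road reads the `Λ_{ℚ(i)}`-generator `L⁺·L⁻_ω` at `T = 0`;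
`L⁺(0) = (1 − α⁻¹)²[0]⁺` is the tree's `constantCoeff_padicLFunction_unitRoot`, this file is its odd twin.

References: B. Mazur, J. Tate, J. Teitelbaum, Invent. Math. 84 (1986) §I.4 (4.2), §I.8 (8.6), §I.10 (10.1),
§I.13, §I.14 [MazurTateTeitelbaum1986Invent].
-/

noncomputable section

open Filter Topology

open scoped MatrixGroups ModularForm

namespace Literature.NumberTheory.EllipticCurves

open CongruenceSubgroup Literature.NumberTheory.EllipticCurves.ModularForms

variable {N : ℕ} [NeZero N] (f : CuspForm (Gamma0 N) 2)

/-- The `2`-adic roots of unity of order dividing `2` are `±1`. [folklore] -/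
private theorem coe_rootsOfUnity_two_eq_one_or_neg_one (ξ : rootsOfUnity 2 ℤ_[2]) :
    ((ξ : ℤ_[2]ˣ) : ℤ_[2]) = 1 ∨ ((ξ : ℤ_[2]ˣ) : ℤ_[2]) = -1 := by
  have h := ξ.2
  rw [mem_rootsOfUnity] at h
  have h' : (((ξ : ℤ_[2]ˣ) : ℤ_[2])) ^ 2 = 1 := by
    rw [← Units.val_pow_eq_pow_val, h, Units.val_one]
  exact sq_eq_one_iff.mp h'

/-- The minus measure on the two unit classes modulo `4`:
`μ⁻(1 + 4ℤ₂) = α⁻²[1/4]⁻ − α⁻³[1/2]⁻` and `μ⁻(3 + 4ℤ₂) = α⁻²[3/4]⁻ − α⁻³[1/2]⁻` (using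
`[3/2]⁻ = [1/2]⁻`). [cite: MazurTateTeitelbaum1986Invent, §I.10 (10.1) and §I.4 (4.2)] -/
theorem msdMinusMeasure_two_two_one_sub_three (α : ℚ_[2]) :
    msdMinusMeasure f α 2 1 - msdMinusMeasure f α 2 (-1) =
      α⁻¹ ^ 2 * ((ratMinusSymbol f (1 / 4) : ℚ_[2]) - (ratMinusSymbol f (3 / 4) : ℚ_[2])) := by
  have h1 : (1 : ZMod (2 ^ 2)).val = 1 := by decide
  have h3 : (-1 : ZMod (2 ^ 2)).val = 3 := by decide
  have hper : ratMinusSymbol f (3 / 2) = ratMinusSymbol f (1 / 2) := by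
    rw [show (3 / 2 : ℚ) = 1 / 2 + (1 : ℤ) by norm_num, ratMinusSymbol_add_intCast]
  have hμ1 : msdMinusMeasure f α 2 1 =
      α⁻¹ ^ 2 * (ratMinusSymbol f (1 / 4) : ℚ_[2]) - α⁻¹ ^ 3 * (ratMinusSymbol f (1 / 2) : ℚ_[2]) := by
    show msdMinusMeasure f α (1 + 1) 1 = _
    simp only [msdMinusMeasure, h1]
    norm_num
  have hμ3 : msdMinusMeasure f α 2 (-1) =
      α⁻¹ ^ 2 * (ratMinusSymbol f (3 / 4) : ℚ_[2]) - α⁻¹ ^ 3 * (ratMinusSymbol f (3 / 2) : ℚ_[2]) := by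
    show msdMinusMeasure f α (1 + 1) (-1) = _
    simp only [msdMinusMeasure, h3]
    norm_num
  rw [hμ1, hμ3, hper]
  ring

/-- **The level-`0` Riemann sum for the constant term of `L⁻₂(f, α, ω, T)`**:
`padicLMinusBranchRiemannSum f α 1 0 0 = α⁻²([1/4]⁻ − [3/4]⁻)` — the sum over the torsion `{±1}` of
`ℤ₂^×` of `ξ · μ⁻_{f,α}(ξ + 4ℤ₂)` (one term `s = 0` of the inner sum, `γ⁰ = 1`, `C(0,0) = 1`).
[cite: MazurTateTeitelbaum1986Invent, §I.13 (p = 2)] -/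
theorem padicLMinusBranchRiemannSum_one_zero_zero_two (α : ℚ_[2]) :
    padicLMinusBranchRiemannSum f α 1 0 0 =
      α⁻¹ ^ 2 * ((ratMinusSymbol f (1 / 4) : ℚ_[2]) - (ratMinusSymbol f (3 / 4) : ℚ_[2])) := by
  classical
  -- the summand as a function of the torsion element
  set G : ℤ_[2] → ℚ_[2] := fun u ↦ ∑ s : ZMod (2 ^ 0),
    (u : ℚ_[2]) ^ 1 * msdMinusMeasure f α (0 + cyclotomicExponent 2)
      (PadicInt.toZModPow (0 + cyclotomicExponent 2) u *
        (cyclotomicGenerator 2 : ZMod (2 ^ (0 + cyclotomicExponent 2))) ^ s.val) *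
      (s.val.choose 0 : ℚ_[2]) with hG
  have hRS : padicLMinusBranchRiemannSum f α 1 0 0 =
      ∑ᶠ ξ : rootsOfUnity (torsionOrder 2) ℤ_[2], G ((ξ : ℤ_[2]ˣ) : ℤ_[2]) := by
    rw [padicLMinusBranchRiemannSum, hG]
  have he : 0 + cyclotomicExponent 2 = 2 := by rw [cyclotomicExponent_two]
  have hs : ∀ s : ZMod (2 ^ 0), s.val = 0 := fun s => Nat.lt_one_iff.mp (by simpa using ZMod.val_lt s)
  have hGu : ∀ u : ℤ_[2], G u = (u : ℚ_[2]) * msdMinusMeasure f α 2 (PadicInt.toZModPow 2 u) := by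
    intro u
    rw [hG]
    dsimp only
    rw [Finset.sum_congr rfl fun s _ => by rw [hs s], Finset.sum_const, Finset.card_univ, ZMod.card,
      pow_zero, one_smul, pow_zero, mul_one, Nat.choose_zero_right, Nat.cast_one, mul_one, pow_one, he]
  -- the torsion group at `2` is `{1, ζ}` with `ζ = -1`
  have hζmem : (-1 : ℤ_[2]ˣ) ∈ rootsOfUnity 2 ℤ_[2] := by
    rw [mem_rootsOfUnity]; norm_num
  set ζ : rootsOfUnity 2 ℤ_[2] := ⟨-1, hζmem⟩ with hζ
  have hne : (1 : rootsOfUnity 2 ℤ_[2]) ≠ ζ := by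
    intro h
    have h' : (((1 : rootsOfUnity 2 ℤ_[2]) : ℤ_[2]ˣ) : ℤ_[2]) = ((ζ : ℤ_[2]ˣ) : ℤ_[2]) := by rw [h]
    rw [hζ] at h'
    simp only [OneMemClass.coe_one, Units.val_one, Units.val_neg] at h'
    have h2 : (2 : ℤ_[2]) = 0 := by linear_combination h'
    exact two_ne_zero h2
  haveI : Fintype (rootsOfUnity 2 ℤ_[2]) := Fintype.ofFinite _
  have huniv : (Finset.univ : Finset (rootsOfUnity 2 ℤ_[2])) = {1, ζ} := by
    ext ξ
    simp only [Finset.mem_univ, Finset.mem_insert, Finset.mem_singleton, true_iff]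
    rcases coe_rootsOfUnity_two_eq_one_or_neg_one ξ with h | h
    · left
      exact Subtype.ext (Units.ext (by simpa using h))
    · right
      exact Subtype.ext (Units.ext (by rw [hζ]; simpa using h))
  rw [hRS, torsionOrder_two, finsum_eq_sum_of_fintype, huniv, Finset.sum_pair hne]
  simp only [OneMemClass.coe_one, Units.val_one, hζ, Units.val_neg]
  rw [hGu, hGu, map_one, map_neg, map_one, PadicInt.coe_one, PadicInt.coe_neg, PadicInt.coe_one, one_mul,
    neg_one_mul, ← sub_eq_add_neg, msdMinusMeasure_two_two_one_sub_three]

/-- **The constant term of the odd branch at `2`**: granted the distribution relation of `μ⁻_{f,α}`,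
`constantCoeff (L⁻₂(f, α, ω, T)) = α⁻² · ([1/4]⁻_f − [3/4]⁻_f)` (`= α⁻² Σ_{a mod 4} χ₋₄(a)[a/4]⁻_f`).
Proof: the constant term is the common value of the (constant) Riemann sums
(`padicLMinusBranchCoeff_zero_eq`, `padicLMinusBranchRiemannSum_zero_eq`), read at level `0`.
[cite: MazurTateTeitelbaum1986Invent, §I.13–I.14] -/
theorem constantCoeff_padicLFunctionMinusBranch_one_two {α : ℚ_[2]}
    (hdist : ∀ (n : ℕ) (a : ZMod (2 ^ n)),
      ∑ b ∈ Finset.univ.filter (fun b : ZMod (2 ^ (n + 1)) ↦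
        ZMod.castHom (pow_dvd_pow 2 n.le_succ) (ZMod (2 ^ n)) b = a), msdMinusMeasure f α (n + 1) b =
        msdMinusMeasure f α n a) :
    PowerSeries.constantCoeff (padicLFunctionMinusBranch f α 1) =
      α⁻¹ ^ 2 * ((ratMinusSymbol f (1 / 4) : ℚ_[2]) - (ratMinusSymbol f (3 / 4) : ℚ_[2])) := by
  rw [constantCoeff_padicLFunctionMinusBranch_eq hdist 1, ← padicLMinusBranchRiemannSum_zero_eq hdist 1 0,
    padicLMinusBranchRiemannSum_one_zero_zero_two]

/-- **The constant term of the odd branch at `2` for a RATIONAL NEWFORM** `f` of level prime to `2` and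
`α` a root of `X² − a₂X + 2` (`α ≠ 0`): `constantCoeff (L⁻₂(f, α, ω, T)) = α⁻² · ([1/4]⁻_f − [3/4]⁻_f)`,
the distribution relation being the tree's `sum_fiber_msdMinusMeasure_succ_eq_of_coeffField`
(Manin–Drinfeld rationality + the Hecke relation at `2`). [cite: MazurTateTeitelbaum1986Invent, §I.10 (10.2), §I.13] -/
theorem constantCoeff_padicLFunctionMinusBranch_one_two_of_coeffField (hf : IsNewform0 f)
    (hQ : coeffField f = ⊥) (h2N : ¬ 2 ∣ N) {a₂ : ℤ} (ha₂ : cuspCoeff f 2 = a₂) {α : ℚ_[2]}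
    (hα₀ : α ≠ 0) (hα : α ^ 2 - a₂ * α + 2 = 0) :
    PowerSeries.constantCoeff (padicLFunctionMinusBranch f α 1) =
      α⁻¹ ^ 2 * ((ratMinusSymbol f (1 / 4) : ℚ_[2]) - (ratMinusSymbol f (3 / 4) : ℚ_[2])) :=
  constantCoeff_padicLFunctionMinusBranch_one_two f
    (sum_fiber_msdMinusMeasure_succ_eq_of_coeffField (p := 2) hf hQ h2N ha₂ hα₀ (by exact_mod_cast hα))

end Literature.NumberTheory.EllipticCurves

end
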